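import Summits.ABC.StewartYu.PadicTwistKStep
import Summits.ABC.StewartYu.PadicTwistPMBridge
import HarnessLib

/-!
# Cell abc-stewartyu, WP-Y provider B (v): the `p`-adic k-step on a ± class

`Summits/ABC/StewartYu/PadicTwistPMKStep.lean` — cell `abc-stewartyu`, seat p3 (crux `W80OneModFour`
stmt-ABC-19487; memo-05 §2). ADD-ON on p2's `PadicTwistKStep.lean` (whose `norm_Φ_le_of_zeros` is stated
class-free): `padic_kstep_pm` — p2's `padic_kstep` with the ± class `cls u = sgn(u)·ρ`, running the
analytic step on the sign-twisted coefficients `sgn·pv` (`Φ_natCast_pm`). Kernel-checked beforehand in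
HOME/p3/lean/pm/CHECK_PM_chain.lean. [folklore].
-/

noncomputable section

open NormedSpace Finset IsUltrametricDist
open Literature.NumberTheory.Transcendental
open Literature.NumberTheory.Transcendental.CW77.Setup (Idx Tau tauNorm)
open scoped Nat

namespace Summit.ABC.StewartYu

namespace TwistSetup

variable {p : ℕ} [Fact p.Prime] (S : TwistSetup p) {h Lb : ℕ}

/-- **The `p`-adic k-step on a ± class** (p2's `padic_kstep` with `cls u = sgn(u)·ρ`, `sgn = ±1` on the
support): the rational cores `coreSum_{J,τ''}(2i+1)` vanish for `i < kpts`, `|τ''| < Tlo`; the analytic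
step runs on `φ(sgn·pv)`, whose values at odd integers are `ρˢ·coreSum(pv)(s)`; conclusion exactly as in
`padic_kstep`. [cite: Yu1990, §3] [cite: Waldschmidt1980, Lemma 3.5 (p. 270)] -/
theorem padic_kstep_pm (J₀ J : ℕ) (box : Finset (Idx S.d h Lb)) (pv : Idx S.d h Lb → ℤ)
    (sgn : Idx S.d h Lb → ℤ) (hsgn : ∀ u ∈ box, pv u ≠ 0 → sgn u = 1 ∨ sgn u = -1)
    {ρcl : ℚ_[p]} (hcls : ∀ u ∈ box, pv u ≠ 0 → S.cls u = (sgn u : ℚ_[p]) * ρcl) (hρcl : ρcl ^ S.G = 1)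
    {kpts Tlo t : ℕ} (ht : 1 ≤ t)
    (hzero : ∀ i < kpts, ∀ τ'' : Tau S.d, tauNorm τ'' < Tlo →
      S.toQ.coreSum J₀ J box pv τ'' (2 * i + 1) = 0)
    (hΛ : ‖S.Λ₀‖ ≤ (p : ℝ)⁻¹)
    {Dmax Mmax : ℝ}
    (hDM : ∀ τ : Tau S.d, tauNorm τ + t ≤ Tlo → ∀ s₁, s₁ < 4 * kpts → Odd s₁ →
      ∃ D : ℕ, 0 < D ∧ (D : ℝ) ≤ Dmax ∧ (∃ m : ℤ, (D : ℚ) * S.toQ.coreSum J₀ J box pv τ s₁ = m) ∧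
        |(S.toQ.coreSum J₀ J box pv τ s₁ : ℝ)| ≤ Mmax)
    (hfinal : max ((p : ℝ) ^ (h * Lb / (p - 1)) * ‖S.Λ₀‖ * (p : ℝ) ^ ((t - 1) / (p - 1)) *
          (p : ℝ) ^ PadicCW77.condExp p kpts t)
        ((p : ℝ) ^ (h * Lb) / Real.sqrt p ^ (kpts * t)) < 1 / (Dmax * Mmax)) :
    ∀ s₁, s₁ < 4 * kpts → Odd s₁ → ∀ τ : Tau S.d, tauNorm τ + t ≤ Tlo →
      S.toQ.coreSum J₀ J box pv τ s₁ = 0 := by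
  intro s₁ hs₁ hodd τ hτ
  have hz : ‖((s₁ : ℕ) : ℚ_[p])‖ ≤ 1 := by exact_mod_cast Padic.norm_int_le_one (p := p) (s₁ : ℤ)
  have hzero' : ∀ i < kpts, ∀ τ'' : Tau S.d, tauNorm τ'' < Tlo →
      S.Φ J₀ J box (fun u => sgn u * pv u) τ'' ((2 * i + 1 : ℕ) : ℚ_[p]) = 0 := by
    intro i hi τ'' hτ''
    rw [S.Φ_natCast_pm J₀ J box pv sgn hsgn hcls τ'' (2 * i + 1) ⟨i, rfl⟩, hzero i hi τ'' hτ'',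
      Rat.cast_zero, mul_zero]
  have hcore := (S.norm_Φ_le_of_zeros J₀ J box (fun u => sgn u * pv u) ht hzero' hΛ hz τ hτ).2
  rw [S.norm_Φ_natCast_pm J₀ J box pv sgn hsgn hcls hρcl τ s₁ hodd] at hcore
  obtain ⟨D, hD0, hDle, ⟨m, hm⟩, hM⟩ := hDM τ hτ s₁ hs₁ hodd
  exact PadicCW77.Rat.eq_zero_of_padicNorm_lt (p := p) hD0 hDle hm hM (lt_of_le_of_lt hcore hfinal)

end TwistSetup

end Summit.ABC.StewartYu

end
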